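import Literature.NumberTheory.LFunctions.SuzukiSingleOperatorKernelGrowthProofs
import Literature.NumberTheory.LFunctions.SuzukiSingleOperatorKernelDerivProofs
import Literature.NumberTheory.LFunctions.SuzukiSmallWindows
import HarnessLib

/-!
# Suzuki 2020, Thm. 1.2 DISCHARGED: `Suzuki2020_thm12_holds`

LINE 1 — LABEL: RH-FREE (the named fact `Suzuki2020_thm12` of `SuzukiSingleOperatorKernel.lean` — properties
(K-ii)–(K-v) of Suzuki's spectrally defined single-operator kernel `K_θ`, `θ > 1` — is now a tree theorem; no zero of
`ζ` off the line `Re s ≥ 1` enters any proof). FRAMING (cell rh-crit, D-0074): corpus theorems are RH-FREE literature;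
discharging a hypothesis binder of the DBR column's door theorems is bookkeeping for those routes, not progress toward
RH. bears_on: B-C/B-P (LADDER-RH COLUMN 6, DBR). WHAT THIS IS NOT: not a window certificate beyond the inexplicit
`τ > 0` of (K-v), not a criterion, no RH-relation of `K_θ` (a printed open question); nothing here bears on the truth
of RH.

Source: M. Suzuki, *Integral operators arising from the Riemann zeta function*, Adv. Stud. Pure Math. **84** (2020)
399–411 = arXiv:1907.07302 [Suzuki2020IntegralOperators], Thm. 1.2.

This ≤ 20-line leaf only ASSEMBLES the conjuncts proved in the sibling modules (lander rule, cell rh-crit R54/R54b):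
* (K-ii) continuity, sharp growth `|K_θ(x)| ≤ C e^{x/2}`, Fourier formula — `Suzuki2020_thm12_Kii`
  (`SuzukiSingleOperatorKernelGrowthProofs.lean`, over `SuzukiSingleOperatorKernelProofs.lean` and the unconditional
  Vinogradov–Korobov-strength bound `ZetaLogDerivStripBound.lean`);
* (K-iii) `K_θ = 0` on `(−∞,0)` — `Suzuki2020_thm12_Kiii` (`SuzukiSingleOperatorKernelProofs.lean`);
* (K-iv) differentiability off `{log n}` and local integrability of `K_θ'` — `Suzuki2020_thm12_Kiv`
  (`SuzukiSingleOperatorKernelDerivProofs.lean`, over the series representation (1.12) of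
  `SuzukiSingleOperatorKernelSeries.lean`);
* (K-v) small Fredholm windows — `Suzuki2020_thm12_Kv` (`SuzukiSmallWindows.lean`).

## References

* [Suzuki2020IntegralOperators] M. Suzuki, ASPM 84 (2020) 399–411 = arXiv:1907.07302, Thm. 1.2.
-/

noncomputable section

open MeasureTheory

namespace Literature.NumberTheory.LFunctions

/-- **[Su20] Thm. 1.2 DISCHARGED** (RH-free): the named fact `Suzuki2020_thm12` — for every `θ > 1`, (K-ii) `K_θ` is
continuous with `K_θ(x) ≪ e^{x/2}` and `∫ K_θ(x) e^{izx} dx = exp(−2θ ξ'/ξ(½ − iz))` for `Im z > ½`, (K-iii) `K_θ = 0` on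
`(−∞, 0)`, (K-iv) `K_θ` differentiable off `{log n}` with locally integrable derivative, (K-v) `det(1 ± 𝖪_θ[t]) ≠ 0`
for `0 ≤ t < τ` — holds as typed. Users' `(h : Suzuki2020_thm12)` binders are fed `Suzuki2020_thm12_holds`.
[cite: Suzuki2020IntegralOperators, Thm. 1.2] -/
theorem Suzuki2020_thm12_holds : Suzuki2020_thm12 := by
  intro θ hθ
  obtain ⟨hcont, hgrowth, hfourier⟩ := Suzuki2020_thm12_Kii hθ
  obtain ⟨hdiff, hint⟩ := Suzuki2020_thm12_Kiv hθ
  exact ⟨hcont, hgrowth, hfourier, fun x hx => Suzuki2020_thm12_Kiii hθ hx, hdiff, hint, Suzuki2020_thm12_Kv hθ⟩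

end Literature.NumberTheory.LFunctions

end
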